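import Summits.RiemannHypothesis.RiemannHypothesis.Theses.ScrewLemmaKExtremalRay
import Summits.RiemannHypothesis.RiemannHypothesis.Theorems.IntegerScrewSmoothSectorDefs
import Summits.RiemannHypothesis.RiemannHypothesis.Theorems.ScrewLemmaKExtremalRayNearExtremal
import Summits.RiemannHypothesis.RiemannHypothesis.Theorems.ScrewLemmaKExtremalRayThresholdRoom
import Summits.RiemannHypothesis.RiemannHypothesis.Theorems.ScrewLemmaKExtremalRayAssembly
import Summits.RiemannHypothesis.RiemannHypothesis.Theorems.ScrewLemmaKCoprofileCoprofileIsometry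
import HarnessLib

/-!
# Route `ScrewLemmaKExtremalRay` (L24 «EXTREMAL RAY») — the rung leaf: OPTIMALITY of `π² − 1`

Every item of route `ScrewLemmaKExtremalRay` is now a theorem in the tree:
E1 `NearExtremalGenerators` (`nearExtremalGenerators_proof`, stmt-RiemannHypothesis-22262),
K1 `CoprofileIsometry` (`CoprofileIsometry_holds` ← `ScrewLemmaKCoprofile.coprofileIsometry_proof`,
stmt-RiemannHypothesis-21612),
K2 `CoprofileMoments` (`CoprofileMoments_holds`, stmt-RiemannHypothesis-21613), E0 `ThresholdRoom`
(`thresholdRoom_proof`, stmt-RiemannHypothesis-22263) and the `Assembly` (`assembly_proof`,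
stmt-RiemannHypothesis-22264); the route's deciding theorem `Theses.ScrewLemmaKExtremalRay.closes`
composes them into the registered rung leaf `IntegerScrew.ScrewSmoothSectorKOptimal`:
**for every `K > π² − 1` the smooth-sector inequality `K·h₀² ≤ ∫₀¹(h − h₀)²/y²` fails for some
admissible generator** — the constant `π² − 1` of LEMMA K♯
(`ScrewLemmaKCoprofile.screwSmoothSectorKSharp`) is optimal.  RH-free real analysis (a rung
S-P(P1) statement about lattice sums of `C¹` functions); RH is NOT proved by this and nothing here
bears on the truth of RH.
-/

set_option linter.dupNamespace false

noncomputable section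

namespace Summit.RiemannHypothesis.RiemannHypothesis.Theorems.ScrewLemmaKExtremalRay

/-- **The rung leaf `ScrewSmoothSectorKOptimal` (LEMMA K, optimality of `π² − 1`)**: for every
`K > π² − 1`, `¬ SmoothSectorKInequality K` — by the deciding theorem of route
`ScrewLemmaKExtremalRay` from E1, K1, K2, E0 and the Assembly, all proved in the tree. RH-free.
[folklore] -/
theorem screwSmoothSectorKOptimal :
    Summit.RiemannHypothesis.RiemannHypothesis.Theorems.IntegerScrew.ScrewSmoothSectorKOptimal :=
  Summit.RiemannHypothesis.RiemannHypothesis.Theses.ScrewLemmaKExtremalRay.closes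
    nearExtremalGenerators_proof
    Summit.RiemannHypothesis.RiemannHypothesis.Theses.ScrewLemmaKExtremalRay.CoprofileIsometry_holds
    Summit.RiemannHypothesis.RiemannHypothesis.Theses.ScrewLemmaKExtremalRay.CoprofileMoments_holds
    thresholdRoom_proof assembly_proof

/-- LEMMA K with its SHARP constant, both halves: the inequality holds with `π² − 1`
(`ScrewLemmaKCoprofile.screwSmoothSectorKSharp`) and with no larger constant. RH-free. [folklore] -/
theorem screwSmoothSectorK_sharp_and_optimal :
    Summit.RiemannHypothesis.RiemannHypothesis.Theorems.IntegerScrew.ScrewSmoothSectorKSharp ∧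
      Summit.RiemannHypothesis.RiemannHypothesis.Theorems.IntegerScrew.ScrewSmoothSectorKOptimal :=
  ⟨Summit.RiemannHypothesis.RiemannHypothesis.Theorems.ScrewLemmaKCoprofile.screwSmoothSectorKSharp,
    screwSmoothSectorKOptimal⟩

end Summit.RiemannHypothesis.RiemannHypothesis.Theorems.ScrewLemmaKExtremalRay

end
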